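import Mathlib
import Summits.Ventures.HodgeRepro2.T5HodgeStar
import Summits.Ventures.HodgeRepro2.T5KahlerModel
import Summits.Ventures.HodgeRepro2.T5PrimitiveOneOne
import Summits.Ventures.HodgeRepro2.T5HermNormalisation
import Summits.Ventures.HodgeRepro2.T5TypeOrthogonality
import Summits.Ventures.HodgeRepro2.T5SelfDualSplitting
import Summits.Ventures.HodgeRepro2.T5HodgeIndexData
import Summits.Ventures.HodgeRepro2.T5HodgeIndexTheorem

/-! # T5HodgeIndexModel — the coframe model at a point of a surface IS a `HodgeSurfaceData` (the non-vacuity witness of T5HodgeIndexData's hypotheses), and Theorem 6.33 there recovers the pointwise signature (3, 3) of the self-dual splitting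

Tier 5, N1 support (route/T5-N1-hodge-p6.md §H1 (V5) / §H3; filer p6; blind lane, Mathlib + own rows only;
README §8(d): uses an L-value-free non-vanishing device: NO).

PURPOSE. T5HodgeIndexData takes Theorem 6.32 (Voisin p0128 l. 35) as DATA on an abstract weight-two Hodge structure.
Here the hypotheses are INSTANTIATED SIMULTANEOUSLY on one model: the six-coefficient model Λ² ⊗ ℂ of the complex
2-covectors at a point of a surface (row 15), with Q = the Vol-coefficient of γ ∧ δ, the conjugation `conjC`,
V^{2,0} = ℂ·dz₁∧dz₂, V^{1,1} = the span of the dz_i ∧ dz̄_j (row 41's `oneOne`), V^{0,2} = ℂ·\overline{dz₁∧dz₂},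
ω = the Kähler form (row 41), and the pointwise Theorem 6.32 of rows 15 / 47 / 56 as the positivity / orthogonality
clauses.  So the data of T5HodgeIndexData are jointly satisfiable (`modelData`), and `hodge_index` applied to the model
gives Λ² = P ⊕ N with dim P = 2·1 + 1 = 3 and dim N = 4 − 1 = 3 — exactly row 59's self-dual / anti-self-dual
splitting: `modelData.P = selfDualSubmodule` and `modelData.N = antiSelfDualSubmodule` (`P_eq_selfDual`,
`N_eq_antiSelfDual`), the decomposition of the proof of Theorem 6.33 (p0129 l. 19) and the proof's «sign of H on
L^r H^{a,b}_prim is (−1)^a» checked against each other at one point.  What stays prose: the passage from the point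
to the compact surface and to cohomology classes (the model is one point; the global model forms are rows 30 / 51 /
58 / 63).
-/

namespace Summit.Ventures.HodgeRepro2.T5HodgeIndexModel

open T5HodgeStar T5KahlerModel T5PrimitiveOneOne T5HermNormalisation T5TypeOrthogonality T5SelfDualSplitting
  T5HodgeIndexData T5HodgeIndexTheorem

/-! ## The pieces as linear / additive maps -/

/-- `Q = wedge` (the Vol-coefficient of `γ ∧ δ`, row 15) as a bilinear map. -/
def wedgeₗ : TwoCovector →ₗ[ℂ] TwoCovector →ₗ[ℂ] ℂ :=
  LinearMap.mk₂ ℂ wedge (fun γ γ' δ => by simp [wedge]; ring) (fun c γ δ => by simp [wedge]; ring)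
    (fun γ δ δ' => by simp [wedge]; ring) (fun c γ δ => by simp [wedge]; ring)

/-- `wedgeₗ` evaluates to `wedge`. -/
theorem wedgeₗ_apply (γ δ : TwoCovector) : wedgeₗ γ δ = wedge γ δ := rfl

/-- `wedge` is symmetric (even degree). -/
theorem wedge_swap (γ δ : TwoCovector) : wedge γ δ = wedge δ γ := by simp [wedge]; ring

/-- The conjugation `conjC` (row 15) as an additive map. -/
def conjCₐ : TwoCovector →+ TwoCovector where
  toFun := conjC
  map_zero' := by ext i; simp [conjC]
  map_add' := conjC_add

/-- `conjCₐ` evaluates to `conjC`. -/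
theorem conjCₐ_apply (γ : TwoCovector) : conjCₐ γ = conjC γ := rfl

/-- `conjC 0 = 0`. -/
theorem conjC_zero : conjC (0 : TwoCovector) = 0 := by ext i; simp [conjC]

/-- `conjC` is conjugate-linear. -/
theorem conjC_smul (z : ℂ) (γ : TwoCovector) : conjC (z • γ) = (starRingEnd ℂ) z • conjC γ := by
  ext i; simp [conjC]

/-- Row 41's `oneOne` (the (1,1)-covectors `Σ c_ij dz_i ∧ dz̄_j`) as a linear map. -/
def oneOneₗ : (Fin 2 → Fin 2 → ℂ) →ₗ[ℂ] TwoCovector where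
  toFun := oneOne
  map_add' c c' := by
    simp only [oneOne, Pi.add_apply, add_smul]; abel
  map_smul' z c := by
    simp only [oneOne, Pi.smul_apply, smul_eq_mul, RingHom.id_apply, smul_add, smul_smul]

/-- `oneOneₗ` evaluates to `oneOne`. -/
theorem oneOneₗ_apply (c : Fin 2 → Fin 2 → ℂ) : oneOneₗ c = oneOne c := rfl

/-- The coordinates of `oneOne c`. -/
theorem oneOne_apply (c : Fin 2 → Fin 2 → ℂ) :
    oneOne c = ![-2 * Complex.I * c 0 0, c 0 1 - c 1 0, -Complex.I * c 0 1 - Complex.I * c 1 0,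
      Complex.I * c 0 1 + Complex.I * c 1 0, c 0 1 - c 1 0, -2 * Complex.I * c 1 1] := by
  ext i; fin_cases i <;> simp [oneOne, dz1dzbar1, dz1dzbar2, dz2dzbar1, dz2dzbar2] <;> ring

/-- `oneOne` is injective (the four coefficients are read off the coordinates). -/
theorem oneOne_injective : Function.Injective oneOne := by
  intro c c' h
  rw [oneOne_apply, oneOne_apply] at h
  have h0 := congrFun h 0
  have h1 := congrFun h 1
  have h3 := congrFun h 3
  have h5 := congrFun h 5
  simp only [Matrix.cons_val_zero, Matrix.cons_val_one, Matrix.cons_val] at h0 h1 h3 h5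
  have i0 : Complex.I ≠ 0 := Complex.I_ne_zero
  have e00 : c 0 0 = c' 0 0 :=
    mul_left_cancel₀ (mul_ne_zero two_ne_zero i0)
      (by linear_combination -h0 : 2 * Complex.I * c 0 0 = 2 * Complex.I * c' 0 0)
  have e11 : c 1 1 = c' 1 1 :=
    mul_left_cancel₀ (mul_ne_zero two_ne_zero i0)
      (by linear_combination -h5 : 2 * Complex.I * c 1 1 = 2 * Complex.I * c' 1 1)
  have e3 : c 0 1 + c 1 0 = c' 0 1 + c' 1 0 :=
    mul_left_cancel₀ i0
      (by linear_combination h3 : Complex.I * (c 0 1 + c 1 0) = Complex.I * (c' 0 1 + c' 1 0))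
  have e01 : c 0 1 = c' 0 1 := by linear_combination (h1 + e3) / 2
  have e10 : c 1 0 = c' 1 0 := by linear_combination (e3 - h1) / 2
  ext i j
  fin_cases i <;> fin_cases j <;> simp [e00, e01, e10, e11]

/-! ## The three types as subspaces -/

/-- `V^{2,0} = ℂ · dz₁ ∧ dz₂`. -/
def V20 : Submodule ℂ TwoCovector := ℂ ∙ dz12

/-- `V^{1,1} = ⟨dz_i ∧ dz̄_j⟩`, the range of `oneOne`. -/
def V11 : Submodule ℂ TwoCovector := LinearMap.range oneOneₗ

/-- `V^{0,2} = ℂ · \overline{dz₁ ∧ dz₂}`. -/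
def V02 : Submodule ℂ TwoCovector := ℂ ∙ conjC dz12

/-- Membership in `V^{2,0}`: the (2,0)-covectors `twoZero b = b · dz₁ ∧ dz₂`. -/
theorem mem_V20_iff (γ : TwoCovector) : γ ∈ V20 ↔ ∃ b, γ = twoZero b := mem_span_dz12_iff γ

/-- Membership in `V^{1,1}`. -/
theorem mem_V11_iff (γ : TwoCovector) : γ ∈ V11 ↔ ∃ c, γ = oneOne c := by
  simp only [V11, LinearMap.mem_range, oneOneₗ_apply]
  exact ⟨fun ⟨c, h⟩ => ⟨c, h.symm⟩, fun ⟨c, h⟩ => ⟨c, h.symm⟩⟩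

/-- Membership in `V^{0,2}`: the conjugates of the (2,0)-covectors. -/
theorem mem_V02_iff (γ : TwoCovector) : γ ∈ V02 ↔ ∃ b, γ = conjC (twoZero b) := by
  simp only [V02, Submodule.mem_span_singleton]
  constructor
  · rintro ⟨a, rfl⟩
    refine ⟨(starRingEnd ℂ) a, ?_⟩
    rw [twoZero, conjC_smul, Complex.conj_conj]
  · rintro ⟨b, rfl⟩
    exact ⟨(starRingEnd ℂ) b, by rw [twoZero, conjC_smul]⟩

/-- `dim V^{2,0} = 1`. -/
theorem finrank_V20 : Module.finrank ℂ V20 = 1 :=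
  finrank_span_singleton (by intro h; have := congrFun h 1; simp [dz12] at this)

/-- `dim V^{1,1} = 4`. -/
theorem finrank_V11 : Module.finrank ℂ V11 = 4 := by
  rw [V11, LinearMap.finrank_range_of_inj oneOne_injective]
  simp [Module.finrank_pi_fintype]

/-- The coordinates of a sum of the three types. -/
theorem types_apply (a b : ℂ) (c : Fin 2 → Fin 2 → ℂ) :
    twoZero a + oneOne c + conjC (twoZero b) =
      ![-2 * Complex.I * c 0 0, a + (c 0 1 - c 1 0) + (starRingEnd ℂ) b,
        Complex.I * a + (-Complex.I * c 0 1 - Complex.I * c 1 0) - Complex.I * (starRingEnd ℂ) b,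
        Complex.I * a + (Complex.I * c 0 1 + Complex.I * c 1 0) - Complex.I * (starRingEnd ℂ) b,
        -a + (c 0 1 - c 1 0) - (starRingEnd ℂ) b, -2 * Complex.I * c 1 1] := by
  rw [oneOne_apply]
  ext i; fin_cases i <;> simp [twoZero, dz12, conjC] <;> ring

/-- `V^{2,0} ∩ V^{1,1} = 0`. -/
theorem disjoint_V20_V11 : Disjoint V20 V11 := by
  rw [Submodule.disjoint_def]
  intro γ h20 h11
  obtain ⟨a, rfl⟩ := (mem_V20_iff γ).mp h20
  obtain ⟨c, hc⟩ := (mem_V11_iff _).mp h11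
  rw [oneOne_apply] at hc
  have h1 := congrFun hc 1
  have h4 := congrFun hc 4
  simp [twoZero, dz12] at h1 h4
  have : a = 0 := by linear_combination (h1 - h4) / 2
  simp [this, twoZero]

/-- `(V^{2,0} ⊕ V^{1,1}) ∩ V^{0,2} = 0`. -/
theorem disjoint_sup_V02 : Disjoint (V20 ⊔ V11) V02 := by
  rw [Submodule.disjoint_def]
  intro γ hsup h02
  obtain ⟨x, hx, y, hy, rfl⟩ := Submodule.mem_sup.mp hsup
  obtain ⟨a, rfl⟩ := (mem_V20_iff x).mp hx
  obtain ⟨c, rfl⟩ := (mem_V11_iff y).mp hy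
  obtain ⟨b, hb⟩ := (mem_V02_iff _).mp h02
  have hb' : twoZero a + oneOne c + conjC (twoZero b) = conjC (twoZero b) + conjC (twoZero b) := by
    rw [← hb]
  rw [types_apply] at hb'
  have h1 := congrFun hb' 1
  have h2 := congrFun hb' 2
  have h3 := congrFun hb' 3
  have h4 := congrFun hb' 4
  simp [twoZero, dz12, conjC] at h1 h2 h3 h4
  have i0 : Complex.I ≠ 0 := Complex.I_ne_zero
  have e1 : a = (starRingEnd ℂ) b := by linear_combination (h1 - h4) / 2
  have e2 : Complex.I * a = -(Complex.I * (starRingEnd ℂ) b) := by linear_combination (h2 + h3) / 2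
  have e3 : a = -(starRingEnd ℂ) b := by
    have := mul_left_cancel₀ i0 (by linear_combination e2 : Complex.I * a = Complex.I * (-(starRingEnd ℂ) b))
    exact this
  have hb0 : (starRingEnd ℂ) b = 0 := by linear_combination (e3 - e1) / 2
  have : b = 0 := by simpa using hb0
  rw [hb, this, twoZero, zero_smul, conjC_zero]

/-- `V^{2,0} ⊔ V^{1,1} ⊔ V^{0,2} = Λ²` (row 53's type decomposition). -/
theorem sup_types_eq_top : V20 ⊔ V11 ⊔ V02 = ⊤ := by
  rw [eq_top_iff]
  intro γ _
  obtain ⟨a, c, b, rfl⟩ := exists_type_decomposition γ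
  refine Submodule.add_mem _ (Submodule.add_mem _ ?_ ?_) ?_
  · exact Submodule.mem_sup_left (Submodule.mem_sup_left ((mem_V20_iff _).mpr ⟨a, rfl⟩))
  · exact Submodule.mem_sup_left (Submodule.mem_sup_right ((mem_V11_iff _).mpr ⟨c, rfl⟩))
  · exact Submodule.mem_sup_right ((mem_V02_iff _).mpr ⟨b, rfl⟩)

/-! ## The datum -/

/-- `conjC` of the Kähler form is the Kähler form (ω is real). -/
theorem conjC_kahler : conjC kahler = kahler := by
  ext i; fin_cases i <;> simp [conjC, kahler]

/-- THE COFRAME MODEL AT A POINT AS A `HodgeSurfaceData`: Theorem 6.32's hypotheses hold pointwise in the model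
(rows 15 / 47 / 56), so the data of T5HodgeIndexData are jointly satisfiable. -/
noncomputable def modelData : HodgeSurfaceData TwoCovector where
  Q := wedgeₗ
  Q_symm := wedge_swap
  conj := conjCₐ
  conj_smul := conjC_smul
  conj_conj := conjC_conjC
  Q_conj := wedge_conjC_conjC
  V20 := V20
  V11 := V11
  V02 := V02
  sup_eq_top := sup_types_eq_top
  disjoint_20_11 := disjoint_V20_V11
  disjoint_sup_02 := disjoint_sup_V02
  conj_mem_20 := by
    intro γ h
    obtain ⟨b, rfl⟩ := (mem_V20_iff γ).mp h
    exact (mem_V02_iff _).mpr ⟨b, rfl⟩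
  conj_mem_02 := by
    intro γ h
    obtain ⟨b, rfl⟩ := (mem_V02_iff γ).mp h
    exact (mem_V20_iff _).mpr ⟨b, by rw [conjCₐ_apply, conjC_conjC]⟩
  conj_mem_11 := by
    intro γ h
    obtain ⟨c, rfl⟩ := (mem_V11_iff γ).mp h
    exact (mem_V11_iff _).mpr ⟨_, conjC_oneOne c⟩
  ω := kahler
  ω_mem := (mem_V11_iff _).mpr ⟨_, kahler_eq_oneOne⟩
  conj_ω := conjC_kahler
  Q_ω_pos := by rw [wedgeₗ_apply, wedge_kahler_kahler]; norm_num
  orth_20_11 := by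
    intro x hx y hy
    obtain ⟨a, rfl⟩ := (mem_V20_iff x).mp hx
    obtain ⟨c, rfl⟩ := (mem_V11_iff y).mp hy
    exact wedge_twoZero_conjC_oneOne a c
  orth_20_02 := by
    intro x hx y hy
    obtain ⟨a, rfl⟩ := (mem_V20_iff x).mp hx
    obtain ⟨b, rfl⟩ := (mem_V02_iff y).mp hy
    exact wedge_twoZero_conjC_conjC_twoZero a b
  orth_11_02 := by
    intro x hx y hy
    obtain ⟨c, rfl⟩ := (mem_V11_iff x).mp hx
    obtain ⟨b, rfl⟩ := (mem_V02_iff y).mp hy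
    exact wedge_oneOne_conjC_conjC_twoZero c b
  pos_20 := by
    intro x hx _ hne
    obtain ⟨a, rfl⟩ := (mem_V20_iff x).mp hx
    have ha : a ≠ 0 := fun h => hne (by simp [h, twoZero])
    exact wedge_conjC_twoZero_self_pos ha
  pos_02 := by
    intro x hx _ hne
    obtain ⟨b, rfl⟩ := (mem_V02_iff x).mp hx
    have hb : b ≠ 0 := fun h => hne (by rw [h, twoZero, zero_smul, conjC_zero])
    have h := wedge_conjC_twoZero_self_pos hb
    rw [wedgeₗ_apply, conjCₐ_apply, conjC_conjC, wedge_swap]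
    exact h
  neg_11 := by
    intro x hx hQ hne
    obtain ⟨c, rfl⟩ := (mem_V11_iff x).mp hx
    have htr : trace c = 0 := by
      rw [wedgeₗ_apply, wedge_swap, wedge_kahler_oneOne_eq_zero_iff] at hQ
      exact hQ
    exact wedge_conjC_oneOne_self_re_neg c htr hne

/-! ## Theorem 6.33 on the model recovers the self-dual splitting of row 59 -/

/-- `dim P = 3` on the model. -/
theorem finrank_P_model : Module.finrank ℂ modelData.P = 3 := by
  rw [finrank_P modelData]
  show 2 * Module.finrank ℂ V20 + 1 = 3
  rw [finrank_V20]

/-- `dim N = 3` on the model. -/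
theorem finrank_N_model : Module.finrank ℂ modelData.N = 3 := by
  rw [finrank_N modelData]
  show Module.finrank ℂ V11 - 1 = 3
  rw [finrank_V11]

/-- `P ⊆ Λ⁺`: the (2,0)-covectors, ω and the (0,2)-covectors are self-dual (rows 15 / 41). -/
theorem P_le_selfDual : modelData.P ≤ selfDualSubmodule := by
  intro γ hγ
  obtain ⟨u, hu, b, hb, rfl⟩ := Submodule.mem_sup.mp hγ
  obtain ⟨a, ha, w, hw, rfl⟩ := Submodule.mem_sup.mp hu
  obtain ⟨t, rfl⟩ := Submodule.mem_span_singleton.mp hw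
  obtain ⟨a', rfl⟩ := (mem_V20_iff a).mp ha
  obtain ⟨b', rfl⟩ := (mem_V02_iff b).mp hb
  rw [mem_selfDualSubmodule_iff]
  show hodgeStar (twoZero a' + t • kahler + conjC (twoZero b')) = twoZero a' + t • kahler + conjC (twoZero b')
  rw [hodgeStar_add, hodgeStar_add, hodgeStar_twoZero, hodgeStar_smul, hodgeStar_kahler,
    hodgeStar_conjC_twoZero]

/-- `N ⊆ Λ⁻`: the primitive (1,1)-covectors are anti-self-dual (row 47). -/
theorem N_le_antiSelfDual : modelData.N ≤ antiSelfDualSubmodule := by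
  intro γ hγ
  rw [HodgeSurfaceData.mem_N_iff] at hγ
  obtain ⟨h11, hQ⟩ := hγ
  obtain ⟨c, rfl⟩ := (mem_V11_iff γ).mp h11
  have htr : trace c = 0 := by
    rw [show modelData.Q (oneOne c) modelData.ω = wedge (oneOne c) kahler from rfl, wedge_swap,
      wedge_kahler_oneOne_eq_zero_iff] at hQ
    exact hQ
  rw [mem_antiSelfDualSubmodule_iff]
  exact hodgeStar_oneOne_of_trace_eq_zero c htr

/-- `P = Λ⁺` (row 59's self-dual submodule): Theorem 6.33's positive summand on the model. -/
theorem P_eq_selfDual : modelData.P = selfDualSubmodule :=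
  Submodule.eq_of_le_of_finrank_eq P_le_selfDual (by rw [finrank_P_model, finrank_selfDualSubmodule])

/-- `N = Λ⁻` (row 59's anti-self-dual submodule): Theorem 6.33's negative summand on the model. -/
theorem N_eq_antiSelfDual : modelData.N = antiSelfDualSubmodule :=
  Submodule.eq_of_le_of_finrank_eq N_le_antiSelfDual (by rw [finrank_N_model, finrank_antiSelfDualSubmodule])

/-- THEOREM 6.33 ON THE MODEL: Λ² = Λ⁺ ⊕ Λ⁻, H-orthogonal, H positive definite on Λ⁺ and negative definite on Λ⁻,
of dimensions 3 and 3 — the statement of `hodge_index` with the two summands identified with row 59's. -/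
theorem hodge_index_model :
    IsCompl selfDualSubmodule antiSelfDualSubmodule ∧
      (∀ x ∈ selfDualSubmodule, ∀ y ∈ antiSelfDualSubmodule, wedge x (conjC y) = 0) ∧
      (∀ x ∈ selfDualSubmodule, x ≠ 0 → 0 < (wedge x (conjC x)).re) ∧
      (∀ y ∈ antiSelfDualSubmodule, y ≠ 0 → (wedge y (conjC y)).re < 0) ∧
      Module.finrank ℂ selfDualSubmodule = 3 ∧ Module.finrank ℂ antiSelfDualSubmodule = 3 := by
  rw [← P_eq_selfDual, ← N_eq_antiSelfDual]
  exact ⟨modelData.isCompl_P_N, fun _ hx _ hy => modelData.H_eq_zero_of_mem_P_of_mem_N hx hy,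
    fun _ hx hne => modelData.H_self_re_pos_of_mem_P hx hne,
    fun _ hy hne => modelData.H_self_re_neg_of_mem_N hy hne, finrank_P_model, finrank_N_model⟩

end Summit.Ventures.HodgeRepro2.T5HodgeIndexModel
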